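import Summits.QuantumFields.BalabanUV.Beta.SymCorrectorFaceGauge

/-!
# `BalabanUV.Beta.SymCorrectorFaceWeightSplit` — road «BF-x», binder row D1, slot (K) ∕ junction (J1), PART 24 HEAD row (lamf): **THE DRESSED BLOCK SYMBOL IN MASS CURRENCY, SPLIT
# INTO INTERIOR AND FACE** (leaf-03 g33, TT29 = OFFER O-6 of N-1 PS l.54904; the OWNER d1-p2 g25 W-g25-8 (c): «O-6 `abs_faceWeight_le_mass_split` WANTED (the (lamf) way out's socket; GO on
# word, now)»).  TT25's mass letters read the column by ONE envelope over the whole block; for the face gauge generator `Λf[G₀]` (face weight at scalar `n⁴∕2` through the bm-DRESSED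
# column) that envelope is the face-sheet power `(n⁴)⁻¹` (gan24-leaf-05 g53 `PackedColumnEnvelope.abs_colH_G₀_road_le`) and the row reads `≍ n` (N-1 PS).  The way out located there:
# split the block into INTERIOR and FACE sites by a predicate `P` and read each part with ITS OWN column envelope (`Ci` off the faces, `Cf` on them — the OWNER's NEW WANTED
# «G0-COL-ENV-INTERIOR» to gan24-leaf-05, W-g25-8 (a)) against ITS OWN block mass of the weight (`Bi`, `Bf` — for the face weight: `Bi ≤ |ξ|·faceWtSum ≍ |ξ|·n` (g58), `Bf ≤ |ξ|·|box|⁻¹·2(d+1)²n^{d+1}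
# = O(|ξ|)` (leaf-01 `DshFaceMass.sum_faces_abs_lam04_le` through g58's `zetaS = lam04` bridge)): `|symbol| ≤ ((Ci·Bi + Cf·Bf)·e^{δ(d+1)n})·e^{−δ|w − n•y|₁}`.

CONTENT (generic `d`; file-level `(hn : 0 < n)`; `P` ANY decidable site predicate — the record plugs «`x` lies on a face of its block», i.e. leaf-01's filter `∃ i, off n x i = 0 ∨ off n x i = n − 1`):
**`abs_faceWeight_le_mass_split`** (at a site `w`), **`abs_blockSymbol_le_mass_split`** (through a leg `w := legSite ρ z b`, constant `× e^{δ|ρ|₁}`), **`biLoc_diag_mass_split`** ∕ **`biLoc_diag_neg_mass_split`**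
(the diagonal generator `diagK (z b ↦ Σ_α Σ_{x ∈ block(legSite ρ z b)} colH K n μ y α x·c α x)` and its negative are `BiLoc` at `(n•y, n•y)` with constant `(Ci·Bi + Cf·Bf)·e^{δ(|ρ|₁ + (d+1)n)}`, rate `δ∕2`).
[folklore] finite-sum bookkeeping BY NAME over lit `l1_sub_triangle`, TT3a∕TT10's `l1_sub_le_of_mem_blockSitesF ∕ l1_sub_legSite_le ∕ biLoc_diagK_of_abs_le`; an entrywise LETTER with displayed
constants — it prices NO (1.22) row; the record's four inputs (`Ci`, `Cf`, `Bi`, `Bf`) are DISPLAYED hypotheses; no definition, no `def … : Prop`, nothing cited, 0 sorry.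

HONEST DEPENDENCY (cell records, verbatim): «continuum YM on T⁴ ⇐ BetaPertH ∧ nine spine estimates (0/9 proved); BetaPertH ⇐ (D1) ∧ (D4) ∧
CAP+tail; G-an2-4 gates asym, D1 and NE2/3/4.»  HONEST FRAMING (cell contract, verbatim): «discharging `BetaPertH` makes Bałaban's UV stability
UNCONDITIONAL — a real constructive-QFT result; it is NOT the continuum limit and NOT the Clay problem.»  0∕4 row-D1 binders (hW ∕ hR ∕ D1Tel ∕ D1Rep); (J1) ONE OPEN ROW; (K) NOT
closed; NOT D1, NEVER «G-an2-4 closed», NOT `BetaPertH`, NOT continuum, NOT Clay.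

ABSOLUTE RULE (cell charter, verbatim): «No internally-minted statement may enter as a cited fact. Every hypothesis is either kernel-proved in
this package or a verbatim quotation of a PUBLISHED theorem with page reference. The manuscript(s) under audit are NOT citable for their own
disputed steps — they are the thing under adjudication; programme-internal (2001/route/tribunal) claims are never citable.»

Unit `b2b-balaban-beta-d1-formalise-leaf-03` (gen 33), 2026-08-23.  No existing file touched.
-/

noncomputable section

namespace Summit.QuantumFields.BalabanUV.Beta.SymCorrectorFaceWeightSplit

open Finset
open scoped BigOperators
open Literature.MathematicalPhysics.QuantumFieldTheory
open Literature.MathematicalPhysics.QuantumFieldTheory.Balaban1983to89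
open Literature.MathematicalPhysics.QuantumFieldTheory.Balaban1983to89.Beta
open B12Sec2to5 (l1 l1_nonneg)
open ExpKernelCalculus (MKer BiLoc l1_sub_triangle l1_sub_symm)
open OneStepResolventKernel (Fib)
open OneStepKernelFamily (colH)
open AffineAveraging (Site)
open AveragingContours (blk)
open Summit.QuantumFields.BalabanUV.Beta.BorderedHessian (diagK)
open Summit.QuantumFields.BalabanUV.Beta.AveragingWardRootedStencils (legSite)
open Summit.QuantumFields.BalabanUV.Beta.CompositeCorrectorLocality (blockSitesF)
open Summit.QuantumFields.BalabanUV.Beta.SymCorrectorFaceGauge (l1_sub_le_of_mem_blockSitesF l1_sub_legSite_le biLoc_diagK_of_abs_le)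

variable {d : ℕ} {n : ℕ} (hn : 0 < n)
include hn

/-- [folklore] **ONE PART OF THE BLOCK, ONE ENVELOPE, ONE MASS**: on a sub-`Finset` `T ⊆ block(w)` where the column obeys `|colH K n μ y α x| ≤ C·e^{−δ|x − n•y|₁}` (`C, δ ≥ 0`)
and the coefficients have mass `Σ_α Σ_{x ∈ T} |c α x| ≤ B`: `|Σ_α Σ_{x ∈ T} colH·c| ≤ (C·B·e^{δ(d+1)n})·e^{−δ|w − n•y|₁}`. -/
theorem abs_partSymbol_le {K : MKer (d + 1) (Fib d)} {C δ : ℝ} (hC : 0 ≤ C) (hδ : 0 ≤ δ) {μ : Fin (d + 1)} {y w : Site (d + 1)}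
    {T : Finset (Site (d + 1))} (hT : T ⊆ blockSitesF n (blk n w))
    (hcol : ∀ α, ∀ x ∈ T, |colH K n μ y α x| ≤ C * Real.exp (-δ * l1 (x - (n : ℤ) • y)))
    {c : Fin (d + 1) → Site (d + 1) → ℝ} {B : ℝ} (hc : ∑ α : Fin (d + 1), ∑ x ∈ T, |c α x| ≤ B) :
    |∑ α : Fin (d + 1), ∑ x ∈ T, colH K n μ y α x * c α x|
      ≤ (C * B * Real.exp (δ * (((d + 1 : ℕ) : ℝ) * n))) * Real.exp (-δ * l1 (w - (n : ℤ) • y)) := by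
  set E : ℝ := C * Real.exp (δ * (((d + 1 : ℕ) : ℝ) * n)) * Real.exp (-δ * l1 (w - (n : ℤ) • y)) with hE
  have hE0 : 0 ≤ E := by positivity
  have hsup : ∀ α, ∀ x ∈ T, |colH K n μ y α x| ≤ E := by
    intro α x hx
    have hwx : l1 (w - x) ≤ ((d + 1 : ℕ) : ℝ) * n := by rw [l1_sub_symm]; exact l1_sub_le_of_mem_blockSitesF hn (hT hx)
    have htri : l1 (w - (n : ℤ) • y) ≤ ((d + 1 : ℕ) : ℝ) * n + l1 (x - (n : ℤ) • y) := by
      have := l1_sub_triangle w x ((n : ℤ) • y); linarith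
    have hexp : Real.exp (-δ * l1 (x - (n : ℤ) • y))
        ≤ Real.exp (δ * (((d + 1 : ℕ) : ℝ) * n)) * Real.exp (-δ * l1 (w - (n : ℤ) • y)) := by
      rw [← Real.exp_add]
      exact Real.exp_le_exp.2 (by nlinarith)
    calc |colH K n μ y α x| ≤ C * Real.exp (-δ * l1 (x - (n : ℤ) • y)) := hcol α x hx
      _ ≤ C * (Real.exp (δ * (((d + 1 : ℕ) : ℝ) * n)) * Real.exp (-δ * l1 (w - (n : ℤ) • y))) := mul_le_mul_of_nonneg_left hexp hC
      _ = E := by rw [hE]; ring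
  calc |∑ α : Fin (d + 1), ∑ x ∈ T, colH K n μ y α x * c α x|
      ≤ ∑ α : Fin (d + 1), |∑ x ∈ T, colH K n μ y α x * c α x| := Finset.abs_sum_le_sum_abs _ _
    _ ≤ ∑ α : Fin (d + 1), ∑ x ∈ T, |colH K n μ y α x * c α x| := Finset.sum_le_sum fun α _ => Finset.abs_sum_le_sum_abs _ _
    _ ≤ ∑ α : Fin (d + 1), ∑ x ∈ T, E * |c α x| :=
        Finset.sum_le_sum fun α _ => Finset.sum_le_sum fun x hx => by
          rw [abs_mul]; exact mul_le_mul_of_nonneg_right (hsup α x hx) (abs_nonneg _)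
    _ = E * ∑ α : Fin (d + 1), ∑ x ∈ T, |c α x| := by
        rw [Finset.mul_sum]
        refine Finset.sum_congr rfl fun α _ => ?_
        rw [Finset.mul_sum]
    _ ≤ E * B := mul_le_mul_of_nonneg_left hc hE0
    _ = _ := by rw [hE]; ring

/-- [folklore] **THE DRESSED BLOCK SYMBOL AT A SITE, IN MASS CURRENCY, SPLIT BY A SITE PREDICATE** (interior ∕ face): with two column envelopes for the one column `(μ, y)` —
`Ci` off `P`, `Cf` on `P` (common rate `δ ≥ 0`) — and two block masses of the coefficients — `Bi` off `P`, `Bf` on `P`, at every block —, at ANY site `w`: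
`|Σ_α Σ_{x ∈ blockSitesF n (blk n w)} colH K n μ y α x·c α x| ≤ ((Ci·Bi + Cf·Bf)·e^{δ(d+1)n})·e^{−δ|w − n•y|₁}`. -/
theorem abs_faceWeight_le_mass_split {K : MKer (d + 1) (Fib d)} {Ci Cf δ : ℝ} (hCi : 0 ≤ Ci) (hCf : 0 ≤ Cf) (hδ : 0 ≤ δ) {μ : Fin (d + 1)} {y : Site (d + 1)}
    (P : Site (d + 1) → Prop) [DecidablePred P]
    (hint : ∀ α x, ¬ P x → |colH K n μ y α x| ≤ Ci * Real.exp (-δ * l1 (x - (n : ℤ) • y)))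
    (hface : ∀ α x, P x → |colH K n μ y α x| ≤ Cf * Real.exp (-δ * l1 (x - (n : ℤ) • y)))
    {c : Fin (d + 1) → Site (d + 1) → ℝ} {Bi Bf : ℝ}
    (hci : ∀ Y, ∑ α : Fin (d + 1), ∑ x ∈ (blockSitesF n Y).filter (fun x => ¬ P x), |c α x| ≤ Bi)
    (hcf : ∀ Y, ∑ α : Fin (d + 1), ∑ x ∈ (blockSitesF n Y).filter P, |c α x| ≤ Bf) (w : Site (d + 1)) :
    |∑ α : Fin (d + 1), ∑ x ∈ blockSitesF n (blk n w), colH K n μ y α x * c α x|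
      ≤ ((Ci * Bi + Cf * Bf) * Real.exp (δ * (((d + 1 : ℕ) : ℝ) * n))) * Real.exp (-δ * l1 (w - (n : ℤ) • y)) := by
  -- split every inner block sum into its `P` and `¬P` parts
  have hsplit : ∑ α : Fin (d + 1), ∑ x ∈ blockSitesF n (blk n w), colH K n μ y α x * c α x
      = (∑ α : Fin (d + 1), ∑ x ∈ (blockSitesF n (blk n w)).filter P, colH K n μ y α x * c α x)
        + ∑ α : Fin (d + 1), ∑ x ∈ (blockSitesF n (blk n w)).filter (fun x => ¬ P x), colH K n μ y α x * c α x := by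
    rw [← Finset.sum_add_distrib]
    exact Finset.sum_congr rfl fun α _ => (Finset.sum_filter_add_sum_filter_not _ P _).symm
  have hi := abs_partSymbol_le hn hCi hδ (Finset.filter_subset _ _)
    (fun α x hx => hint α x (Finset.mem_filter.1 hx).2) (hci (blk n w))
  have hf := abs_partSymbol_le hn hCf hδ (Finset.filter_subset _ _)
    (fun α x hx => hface α x (Finset.mem_filter.1 hx).2) (hcf (blk n w))
  rw [hsplit]
  refine (abs_add_le _ _).trans ?_
  refine (add_le_add hf hi).trans (le_of_eq ?_)
  ring

/-- [folklore] **THE SAME THROUGH A LEG** `w := legSite ρ z b` (the leg's site is within `|ρ|₁` of `z` — TT10 `l1_sub_legSite_le`): constant `× e^{δ|ρ|₁}`, decay `e^{−δ|z − n•y|₁}`. -/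
theorem abs_blockSymbol_le_mass_split {K : MKer (d + 1) (Fib d)} {Ci Cf δ : ℝ} (hCi : 0 ≤ Ci) (hCf : 0 ≤ Cf) (hδ : 0 ≤ δ) {μ : Fin (d + 1)} {y : Site (d + 1)}
    (P : Site (d + 1) → Prop) [DecidablePred P]
    (hint : ∀ α x, ¬ P x → |colH K n μ y α x| ≤ Ci * Real.exp (-δ * l1 (x - (n : ℤ) • y)))
    (hface : ∀ α x, P x → |colH K n μ y α x| ≤ Cf * Real.exp (-δ * l1 (x - (n : ℤ) • y)))
    (ρ : Site (d + 1)) {c : Fin (d + 1) → Site (d + 1) → ℝ} {Bi Bf : ℝ}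
    (hci : ∀ Y, ∑ α : Fin (d + 1), ∑ x ∈ (blockSitesF n Y).filter (fun x => ¬ P x), |c α x| ≤ Bi)
    (hcf : ∀ Y, ∑ α : Fin (d + 1), ∑ x ∈ (blockSitesF n Y).filter P, |c α x| ≤ Bf) (z : Site (d + 1)) (b : Fib d) :
    |∑ α : Fin (d + 1), ∑ x ∈ blockSitesF n (blk n (legSite ρ z b)), colH K n μ y α x * c α x|
      ≤ ((Ci * Bi + Cf * Bf) * Real.exp (δ * (l1 ρ + ((d + 1 : ℕ) : ℝ) * n))) * Real.exp (-δ * l1 (z - (n : ℤ) • y)) := by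
  have hBi : 0 ≤ Bi := le_trans (Finset.sum_nonneg fun _ _ => Finset.sum_nonneg fun _ _ => abs_nonneg _) (hci 0)
  have hBf : 0 ≤ Bf := le_trans (Finset.sum_nonneg fun _ _ => Finset.sum_nonneg fun _ _ => abs_nonneg _) (hcf 0)
  have h := abs_faceWeight_le_mass_split hn hCi hCf hδ P hint hface hci hcf (legSite ρ z b)
  have hzw : l1 (z - legSite ρ z b) ≤ l1 ρ := l1_sub_legSite_le ρ z b
  have htri : l1 (z - (n : ℤ) • y) ≤ l1 ρ + l1 (legSite ρ z b - (n : ℤ) • y) := by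
    have := l1_sub_triangle z (legSite ρ z b) ((n : ℤ) • y); linarith
  have hexp : Real.exp (-δ * l1 (legSite ρ z b - (n : ℤ) • y)) ≤ Real.exp (δ * l1 ρ) * Real.exp (-δ * l1 (z - (n : ℤ) • y)) := by
    rw [← Real.exp_add]
    exact Real.exp_le_exp.2 (by nlinarith)
  have hK : 0 ≤ (Ci * Bi + Cf * Bf) * Real.exp (δ * (((d + 1 : ℕ) : ℝ) * n)) := by positivity
  refine h.trans ?_
  calc (Ci * Bi + Cf * Bf) * Real.exp (δ * (((d + 1 : ℕ) : ℝ) * n)) * Real.exp (-δ * l1 (legSite ρ z b - (n : ℤ) • y))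
      ≤ (Ci * Bi + Cf * Bf) * Real.exp (δ * (((d + 1 : ℕ) : ℝ) * n)) * (Real.exp (δ * l1 ρ) * Real.exp (-δ * l1 (z - (n : ℤ) • y))) :=
        mul_le_mul_of_nonneg_left hexp hK
    _ = _ := by rw [mul_add δ, Real.exp_add]; ring

/-- [folklore] **THE DIAGONAL GENERATOR WITH THE SPLIT SYMBOL IS `BiLoc` AT `(n•y, n•y)`** — constant `(Ci·Bi + Cf·Bf)·e^{δ(|ρ|₁ + (d+1)n)}`, rate `δ∕2` (TT10 `biLoc_diagK_of_abs_le`). -/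
theorem biLoc_diag_mass_split {K : MKer (d + 1) (Fib d)} {Ci Cf δ : ℝ} (hCi : 0 ≤ Ci) (hCf : 0 ≤ Cf) (hδ : 0 ≤ δ) {μ : Fin (d + 1)} {y : Site (d + 1)}
    (P : Site (d + 1) → Prop) [DecidablePred P]
    (hint : ∀ α x, ¬ P x → |colH K n μ y α x| ≤ Ci * Real.exp (-δ * l1 (x - (n : ℤ) • y)))
    (hface : ∀ α x, P x → |colH K n μ y α x| ≤ Cf * Real.exp (-δ * l1 (x - (n : ℤ) • y)))
    (ρ : Site (d + 1)) {c : Fin (d + 1) → Site (d + 1) → ℝ} {Bi Bf : ℝ}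
    (hci : ∀ Y, ∑ α : Fin (d + 1), ∑ x ∈ (blockSitesF n Y).filter (fun x => ¬ P x), |c α x| ≤ Bi)
    (hcf : ∀ Y, ∑ α : Fin (d + 1), ∑ x ∈ (blockSitesF n Y).filter P, |c α x| ≤ Bf) :
    BiLoc (diagK fun z b => ∑ α : Fin (d + 1), ∑ x ∈ blockSitesF n (blk n (legSite ρ z b)), colH K n μ y α x * c α x)
      ((n : ℤ) • y) ((n : ℤ) • y) ((Ci * Bi + Cf * Bf) * Real.exp (δ * (l1 ρ + ((d + 1 : ℕ) : ℝ) * n))) (δ / 2) :=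
  biLoc_diagK_of_abs_le fun z b => abs_blockSymbol_le_mass_split hn hCi hCf hδ P hint hface ρ hci hcf z b

/-- [folklore] … and so is its negative (the face gauge generator's orientation `Λf = −Θ′[ξ]`). -/
theorem biLoc_diag_neg_mass_split {K : MKer (d + 1) (Fib d)} {Ci Cf δ : ℝ} (hCi : 0 ≤ Ci) (hCf : 0 ≤ Cf) (hδ : 0 ≤ δ) {μ : Fin (d + 1)} {y : Site (d + 1)}
    (P : Site (d + 1) → Prop) [DecidablePred P]
    (hint : ∀ α x, ¬ P x → |colH K n μ y α x| ≤ Ci * Real.exp (-δ * l1 (x - (n : ℤ) • y)))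
    (hface : ∀ α x, P x → |colH K n μ y α x| ≤ Cf * Real.exp (-δ * l1 (x - (n : ℤ) • y)))
    (ρ : Site (d + 1)) {c : Fin (d + 1) → Site (d + 1) → ℝ} {Bi Bf : ℝ}
    (hci : ∀ Y, ∑ α : Fin (d + 1), ∑ x ∈ (blockSitesF n Y).filter (fun x => ¬ P x), |c α x| ≤ Bi)
    (hcf : ∀ Y, ∑ α : Fin (d + 1), ∑ x ∈ (blockSitesF n Y).filter P, |c α x| ≤ Bf) :
    BiLoc (diagK fun z b => -(∑ α : Fin (d + 1), ∑ x ∈ blockSitesF n (blk n (legSite ρ z b)), colH K n μ y α x * c α x))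
      ((n : ℤ) • y) ((n : ℤ) • y) ((Ci * Bi + Cf * Bf) * Real.exp (δ * (l1 ρ + ((d + 1 : ℕ) : ℝ) * n))) (δ / 2) :=
  biLoc_diagK_of_abs_le fun z b => by
    rw [abs_neg]
    exact abs_blockSymbol_le_mass_split hn hCi hCf hδ P hint hface ρ hci hcf z b

end Summit.QuantumFields.BalabanUV.Beta.SymCorrectorFaceWeightSplit

end
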